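import Literature.NumberTheory.Rogawski1990.SingularLocalConjugacy            -- ★ frames at a singular class: `twistGram`, `finSum` currency (and, downstream, ★ rank-2 congruence by the determinant class)
import HarnessLib

/-!
# Frames with a scalar block: the Gram matrix of the frame of a matched regular unitary element is BLOCK DIAGONAL; blockwise congruences transport frames by a
# UNITARY; two frame realisations with the same scalar block have the same rank-`N₁` Gram class (Rogawski 1990, §3.8 Prop. 3.8.1 bookkeeping, ring-generic)

Topic `NumberTheory/Rogawski1990`; namespace `Literature.NumberTheory.Rogawski1990`.  THEOREMS ONLY (no definition, no instance, no notation, no named fact,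
no `sorry`); any commutative ring `S` with an endomorphism `σ`.  Cell `pub/hodgecm-mathlib` (D-0151), crux H413 = stmt-HodgeConjecture-24833, F0∕P3a road «D-N6-ns»,
floor-2 line «N6nsGerm», stub `stub_N6nsS1`; brick **B3-alg** (FILE 1 of 2) of the (α′) junction `LocalTransferCentralSingularJunctionCM` (F0P2-p02 (g8); LEAD F0P3a-plan
(g9) WORD T8-63 (B), T8-65 (2)); seat F0P3a-p08 (g13).  HONEST LABEL: HC_CM is proved only modulo the printed citations until rung 0 closes; this file is
unconditional linear algebra and proves no letter.  FILE 2 = ★ `LocalNormFibreBlockDichotomy` (the dichotomy over `E_v`).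

THE MATHEMATICS.  A `G`-regular `γ_H = (A, b) ∈ H_v` matched with `γ′ ∈ U(H)` hands over a frame for free: `γ′ Q = Q (A ⊕ᶠ b·1)` with `σ(b) b = 1` and `χ_A(b)` a unit.
(i) Unitarity of `γ′` forces the Gram matrix `Γ = ᵗ(σQ) H Q` to be BLOCK DIAGONAL: `ᵗσ(A ⊕ᶠ b)·Γ·(A ⊕ᶠ b) = Γ` gives `Γ₂₁ A = b Γ₂₁` and `ᵗ(σA) Γ₁₂ = σ(b) Γ₁₂`, and
Cayley–Hamilton with the units `χ_A(b)`, `σ(χ_A(b))` kills both off-diagonal blocks (row-form Sylvester: `y B = l y ⇒ y p(B) = p(l) y`; no eigenvectors).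
(ii) Blockwise congruences between the Gram blocks of two frames `P`, `Q` assemble to the UNITARY `x = P (t₁ ⊕ᶠ t₂) Q⁻¹` with `(x γ′ x⁻¹) P = P (t₁ A t₁⁻¹ ⊕ᶠ b·1)`.
(iii) Conversely, if a unitary intertwines `P (B ⊕ᶠ l) P⁻¹` with `P′ (B′ ⊕ᶠ l) P′⁻¹` (same scalar `l`, `χ_B(l)`, `χ_{B′}(l)` units) then it is block diagonal in the frames
and `det G₁ = N(det s₁) det G₁′` for the rank-`N₁` Gram blocks.  (iv) Rank-1 bookkeeping: a rank-`N₁` congruence class forces the `1 × 1` one via `det(ᵗσP H P) = N(det P) det H`.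

* `mul_aeval_eq_eval_smul_of_mul_eq_smul`, `eq_zero_of_mul_eq_smul_of_isUnit_eval_charpoly` (row Sylvester); **`twistGram_eq_finSum_of_frame_unitary`** (i);
  **`exists_unitary_frame_transport`** (ii); **`exists_det_eq_norm_mul_of_frames`** (iii); `exists_rank_one_eq_norm_smul` (iv).

## References
* [Rogawski1990] J. D. Rogawski, *Automorphic Representations of Unitary Groups in Three Variables*, Ann. of Math. Stud. 123 (1990): §3.1 p. 19; §3.8 Prop. 3.8.1 (d) p. 30;
  §8.1 pp. 115–116.
* [HornJohnson2013] R. A. Horn, C. R. Johnson, *Matrix Analysis*, 2nd ed. (2013), §2.4.4 (Sylvester's equation; block-diagonal intertwiners, Cor. 2.4.4.2).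
-/

set_option autoImplicit false

noncomputable section

open NumberField IsDedekindDomain Matrix Polynomial
open scoped MatrixGroups

namespace Literature.NumberTheory.Rogawski1990

open Literature.NumberTheory.Automorphic
open Literature.NumberTheory.Automorphic.UnitaryGroup (finSum finSum_map det_finSum transpose_finSum_map)
open Literature.AlgebraicGeometry.ShimuraVarieties (unitaryGroup)

/-! ## §1 Ring-generic: the frame of a matched regular element has block-diagonal Gram matrix; frame transport by blockwise congruences -/

section Generic

variable {S : Type*} [CommRing S] (σ : S →+* S) {N₁ N₂ : ℕ}

/-- `(A ⊕ᶠ B)(C ⊕ᶠ D) = AC ⊕ᶠ BD`. [folklore] -/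
private theorem finSum_mul_finSum₃ (A C : Matrix (Fin N₁) (Fin N₁) S) (B D : Matrix (Fin N₂) (Fin N₂) S) :
    finSum N₁ N₂ A B * finSum N₁ N₂ C D = finSum N₁ N₂ (A * C) (B * D) := by
  simp only [finSum, Matrix.reindex_apply, Matrix.submatrix_mul_equiv, Matrix.fromBlocks_multiply, Matrix.mul_zero, Matrix.zero_mul,
    add_zero, zero_add]

/-- `1 ⊕ᶠ 1 = 1`. [folklore] -/
private theorem finSum_one_one₃ : finSum N₁ N₂ (1 : Matrix (Fin N₁) (Fin N₁) S) (1 : Matrix (Fin N₂) (Fin N₂) S) = 1 := by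
  simp only [finSum, Matrix.fromBlocks_one, Matrix.reindex_apply, Matrix.submatrix_one_equiv]

/-- `⊕ᶠ` is injective in the pair of blocks. [folklore] -/
private theorem finSum_inj₃ {A C : Matrix (Fin N₁) (Fin N₁) S} {B D : Matrix (Fin N₂) (Fin N₂) S}
    (h : finSum N₁ N₂ A B = finSum N₁ N₂ C D) : A = C ∧ B = D := by
  have h' := (Matrix.reindex finSumFinEquiv finSumFinEquiv).injective h
  rw [Matrix.fromBlocks_inj] at h'
  exact ⟨h'.1, h'.2.2.2⟩

/-- `twistGram` of block-diagonal data is block diagonal. [folklore] -/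
private theorem twistGram_finSum_finSum₃ (J₁ t₁ : Matrix (Fin N₁) (Fin N₁) S) (J₂ t₂ : Matrix (Fin N₂) (Fin N₂) S) :
    twistGram σ (finSum N₁ N₂ J₁ J₂) (finSum N₁ N₂ t₁ t₂) = finSum N₁ N₂ (twistGram σ J₁ t₁) (twistGram σ J₂ t₂) := by
  rw [twistGram_def, transpose_finSum_map, finSum_mul_finSum₃, finSum_mul_finSum₃, twistGram_def, twistGram_def]

/-- The block-diagonal unit `t₁ ⊕ᶠ t₂` with its inverse `t₁⁻¹ ⊕ᶠ t₂⁻¹`. [folklore] -/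
private theorem exists_units_finSum₃ (t₁ : GL (Fin N₁) S) (t₂ : GL (Fin N₂) S) :
    ∃ T : GL (Fin (N₁ + N₂)) S, (T : Matrix (Fin (N₁ + N₂)) (Fin (N₁ + N₂)) S) = finSum N₁ N₂ (t₁ : Matrix (Fin N₁) (Fin N₁) S) (t₂ : Matrix (Fin N₂) (Fin N₂) S) ∧
      ((T⁻¹ : GL (Fin (N₁ + N₂)) S) : Matrix (Fin (N₁ + N₂)) (Fin (N₁ + N₂)) S) =
        finSum N₁ N₂ ((t₁⁻¹ : GL (Fin N₁) S) : Matrix (Fin N₁) (Fin N₁) S) ((t₂⁻¹ : GL (Fin N₂) S) : Matrix (Fin N₂) (Fin N₂) S) :=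
  ⟨⟨finSum N₁ N₂ (t₁ : Matrix (Fin N₁) (Fin N₁) S) (t₂ : Matrix (Fin N₂) (Fin N₂) S),
    finSum N₁ N₂ ((t₁⁻¹ : GL (Fin N₁) S) : Matrix (Fin N₁) (Fin N₁) S) ((t₂⁻¹ : GL (Fin N₂) S) : Matrix (Fin N₂) (Fin N₂) S),
    by rw [finSum_mul_finSum₃, ← Units.val_mul, ← Units.val_mul, mul_inv_cancel, mul_inv_cancel, Units.val_one, Units.val_one, finSum_one_one₃],
    by rw [finSum_mul_finSum₃, ← Units.val_mul, ← Units.val_mul, inv_mul_cancel, inv_mul_cancel, Units.val_one, Units.val_one, finSum_one_one₃]⟩,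
    rfl, rfl⟩

/-- **Sylvester with a polynomial witness, row form**: `y B = l·y` ⇒ `y·p(B) = p(l)·y` for every polynomial `p`. [cite: HornJohnson2013, §2.4.4] -/
theorem mul_aeval_eq_eval_smul_of_mul_eq_smul {ι κ : Type*} [Fintype κ] [DecidableEq κ] {y : Matrix ι κ S} {B : Matrix κ κ S} {l : S}
    (h : y * B = l • y) (p : S[X]) : y * aeval B p = p.eval l • y := by
  have hpow : ∀ n : ℕ, y * B ^ n = l ^ n • y := by
    intro n
    induction n with
    | zero => rw [pow_zero, pow_zero, Matrix.mul_one, one_smul]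
    | succ n ih => rw [pow_succ, ← Matrix.mul_assoc, ih, Matrix.smul_mul, h, smul_smul, pow_succ]
  induction p using Polynomial.induction_on' with
  | add p q hp hq => rw [map_add, Matrix.mul_add, hp, hq, eval_add, add_smul]
  | monomial n c =>
    rw [← C_mul_X_pow_eq_monomial, map_mul, map_pow, aeval_C, aeval_X, eval_mul, eval_C, eval_pow, eval_X, Algebra.algebraMap_eq_smul_one,
      Matrix.smul_mul, Matrix.one_mul, Matrix.mul_smul, hpow, smul_smul]

/-- `y B = l·y` with `χ_B(l)` a unit ⇒ `y = 0` (Cayley–Hamilton). [cite: HornJohnson2013, §2.4.4 Cor. 2.4.4.2] -/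
theorem eq_zero_of_mul_eq_smul_of_isUnit_eval_charpoly {ι κ : Type*} [Fintype κ] [DecidableEq κ] {y : Matrix ι κ S} {B : Matrix κ κ S} {l : S}
    (h : y * B = l • y) (hχ : IsUnit (B.charpoly.eval l)) : y = 0 := by
  have key := mul_aeval_eq_eval_smul_of_mul_eq_smul h B.charpoly
  rw [Matrix.aeval_self_charpoly, Matrix.mul_zero] at key
  obtain ⟨u, hu⟩ := hχ
  have h2 := congrArg (fun M : Matrix ι κ S => ((u⁻¹ : Sˣ) : S) • M) key
  simp only [smul_zero, smul_smul, ← hu, Units.inv_mul, one_smul] at h2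
  exact h2.symm

/-- **THE FRAME OF A MATCHED REGULAR ELEMENT HAS BLOCK-DIAGONAL GRAM MATRIX.**  `γ ∈ U_σ(H)` with `γ Q = Q (B₀ ⊕ᶠ l·1)`, `σ(l) l = 1`, `χ_{B₀}(l)` a unit ⇒
`ᵗ(σQ) H Q = Γ₁ ⊕ᶠ Γ₂`: unitarity gives `ᵗσ(B₀ ⊕ᶠ l)·Γ·(B₀ ⊕ᶠ l) = Γ`, i.e. `Γ₂₁ B₀ = l Γ₂₁` and `ᵗ(σB₀) Γ₁₂ = σ(l) Γ₁₂`, and Cayley–Hamilton with the units `χ_{B₀}(l)`,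
`σ(χ_{B₀}(l))` kills both off-diagonal blocks (no eigenvectors, any commutative ring). [cite: Rogawski1990, §3.8 Prop. 3.8.1 p. 30; §3.1 p. 19] [cite: HornJohnson2013, §2.4.4] -/
theorem twistGram_eq_finSum_of_frame_unitary (H : Matrix (Fin (N₁ + N₂)) (Fin (N₁ + N₂)) S) {γ Q : GL (Fin (N₁ + N₂)) S}
    {B₀ : Matrix (Fin N₁) (Fin N₁) S} {l : S} (hγ : γ ∈ unitaryGroup σ H)
    (hQ : (γ : Matrix (Fin (N₁ + N₂)) (Fin (N₁ + N₂)) S) * (Q : Matrix (Fin (N₁ + N₂)) (Fin (N₁ + N₂)) S) =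
      (Q : Matrix (Fin (N₁ + N₂)) (Fin (N₁ + N₂)) S) * finSum N₁ N₂ B₀ (l • (1 : Matrix (Fin N₂) (Fin N₂) S)))
    (hl : σ l * l = 1) (hχ : IsUnit (B₀.charpoly.eval l)) :
    ∃ (Γ₁ : Matrix (Fin N₁) (Fin N₁) S) (Γ₂ : Matrix (Fin N₂) (Fin N₂) S),
      twistGram σ H (Q : Matrix (Fin (N₁ + N₂)) (Fin (N₁ + N₂)) S) = finSum N₁ N₂ Γ₁ Γ₂ := by
  set Qm : Matrix (Fin (N₁ + N₂)) (Fin (N₁ + N₂)) S := (Q : Matrix (Fin (N₁ + N₂)) (Fin (N₁ + N₂)) S) with hQm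
  set D : Matrix (Fin (N₁ + N₂)) (Fin (N₁ + N₂)) S := finSum N₁ N₂ B₀ (l • (1 : Matrix (Fin N₂) (Fin N₂) S)) with hD
  set Γ : Matrix (Fin (N₁ + N₂)) (Fin (N₁ + N₂)) S := twistGram σ H Qm with hΓ
  -- unitarity transported to the frame: `ᵗσD Γ D = Γ`
  have key : (D.map σ)ᵀ * Γ * D = Γ := by
    rw [hΓ, ← twistGram_mul, ← hQ, twistGram_mul, twistGram_coe_eq_of_mem_unitaryGroup σ H hγ, ← twistGram_def]
  -- read in the `Fin N₁ ⊕ Fin N₂` indexing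
  set y : Matrix (Fin N₁ ⊕ Fin N₂) (Fin N₁ ⊕ Fin N₂) S := Γ.submatrix finSumFinEquiv finSumFinEquiv with hydef
  have hΓy : Γ = Matrix.reindex finSumFinEquiv finSumFinEquiv y := by
    rw [hydef, Matrix.reindex_apply, Matrix.submatrix_submatrix, Equiv.self_comp_symm, Matrix.submatrix_id_id]
  have hDt : (D.map σ)ᵀ = finSum N₁ N₂ ((B₀.map σ)ᵀ) (σ l • (1 : Matrix (Fin N₂) (Fin N₂) S)) := by
    rw [hD, transpose_finSum_map, Matrix.map_smul' _ _ _ (map_mul σ), Matrix.map_one _ (map_zero σ) (map_one σ), Matrix.transpose_smul,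
      Matrix.transpose_one]
  have hy : Matrix.fromBlocks ((B₀.map σ)ᵀ) 0 0 (σ l • (1 : Matrix (Fin N₂) (Fin N₂) S)) * y * Matrix.fromBlocks B₀ 0 0 (l • (1 : Matrix (Fin N₂) (Fin N₂) S)) = y := by
    have h := congrArg (fun M : Matrix (Fin (N₁ + N₂)) (Fin (N₁ + N₂)) S => M.submatrix ⇑finSumFinEquiv ⇑finSumFinEquiv) key
    rw [hDt, hD, finSum, finSum, Matrix.reindex_apply, Matrix.reindex_apply,
      ← Matrix.submatrix_mul_equiv _ _ ⇑finSumFinEquiv finSumFinEquiv ⇑finSumFinEquiv,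
      ← Matrix.submatrix_mul_equiv _ Γ ⇑finSumFinEquiv finSumFinEquiv ⇑finSumFinEquiv, Matrix.submatrix_submatrix, Matrix.submatrix_submatrix,
      Equiv.symm_comp_self, Matrix.submatrix_id_id, Matrix.submatrix_id_id] at h
    exact h
  have hyb := Matrix.fromBlocks_toBlocks y
  rw [← hyb, Matrix.fromBlocks_multiply, Matrix.fromBlocks_multiply] at hy
  simp only [Matrix.mul_zero, Matrix.zero_mul, add_zero, zero_add, Matrix.mul_smul, Matrix.smul_mul, Matrix.mul_one, Matrix.one_mul,
    Matrix.fromBlocks_inj] at hy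
  obtain ⟨-, h₁₂, h₂₁, -⟩ := hy
  -- (2,1): `σl • (y₂₁ B₀) = y₂₁` ⇒ `y₂₁ B₀ = l • y₂₁` ⇒ `y₂₁ = 0`
  have h21 : y.toBlocks₂₁ * B₀ = l • y.toBlocks₂₁ := by
    have h := congrArg (fun M : Matrix (Fin N₂) (Fin N₁) S => l • M) h₂₁
    simp only [smul_smul, mul_comm l (σ l), hl, one_smul] at h
    exact h
  have hC : y.toBlocks₂₁ = 0 := eq_zero_of_mul_eq_smul_of_isUnit_eval_charpoly h21 hχ
  -- (1,2): `l • ((σB₀)ᵀ y₁₂) = y₁₂` ⇒ `ᵗy₁₂ (σB₀) = σl • ᵗy₁₂` ⇒ `y₁₂ = 0`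
  have h12 : (y.toBlocks₁₂)ᵀ * B₀.map σ = σ l • (y.toBlocks₁₂)ᵀ := by
    have h := congrArg (fun M : Matrix (Fin N₁) (Fin N₂) S => (σ l • M)ᵀ) h₁₂
    simp only [smul_smul, hl, one_smul, Matrix.transpose_smul, Matrix.transpose_mul, Matrix.transpose_transpose] at h
    exact h
  have hχσ : IsUnit ((B₀.map σ).charpoly.eval (σ l)) := by
    rw [Matrix.charpoly_map, eval_map, eval₂_at_apply]
    exact hχ.map σ
  have hB : y.toBlocks₁₂ = 0 := by
    have h := eq_zero_of_mul_eq_smul_of_isUnit_eval_charpoly h12 hχσ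
    simpa only [Matrix.transpose_eq_zero] using h
  refine ⟨y.toBlocks₁₁, y.toBlocks₂₂, ?_⟩
  rw [hΓy, ← hyb, hB, hC]
  rfl

/-- **FRAME TRANSPORT BY BLOCKWISE CONGRUENCES.**  Frames `P`, `Q` with block-diagonal Gram matrices `ᵗ(σP) H P = G₁ ⊕ᶠ G₂`, `ᵗ(σQ) H Q = Γ₁ ⊕ᶠ Γ₂`, blockwise
congruences `ᵗ(σt₁) G₁ t₁ = Γ₁`, `ᵗ(σt₂) G₂ t₂ = Γ₂`, and `γ Q = Q (B₀ ⊕ᶠ l·1)`.  Then `x := P (t₁ ⊕ᶠ t₂) Q⁻¹` is UNITARY and `(x γ x⁻¹) P = P (t₁ B₀ t₁⁻¹ ⊕ᶠ l·1)` —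
`x γ x⁻¹` lies in the block centraliser of the frame `P` with second block the scalar `l`. [cite: Rogawski1990, §3.8 Prop. 3.8.1 p. 30; §3.1 p. 19] -/
theorem exists_unitary_frame_transport (H : Matrix (Fin (N₁ + N₂)) (Fin (N₁ + N₂)) S) {P Q γ : GL (Fin (N₁ + N₂)) S}
    {G₁ Γ₁ : Matrix (Fin N₁) (Fin N₁) S} {G₂ Γ₂ : Matrix (Fin N₂) (Fin N₂) S}
    (hP : twistGram σ H (P : Matrix (Fin (N₁ + N₂)) (Fin (N₁ + N₂)) S) = finSum N₁ N₂ G₁ G₂)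
    (hQ : twistGram σ H (Q : Matrix (Fin (N₁ + N₂)) (Fin (N₁ + N₂)) S) = finSum N₁ N₂ Γ₁ Γ₂)
    (t₁ : GL (Fin N₁) S) (ht₁ : twistGram σ G₁ (t₁ : Matrix (Fin N₁) (Fin N₁) S) = Γ₁)
    (t₂ : GL (Fin N₂) S) (ht₂ : twistGram σ G₂ (t₂ : Matrix (Fin N₂) (Fin N₂) S) = Γ₂)
    {B₀ : Matrix (Fin N₁) (Fin N₁) S} {l : S}
    (hγQ : (γ : Matrix (Fin (N₁ + N₂)) (Fin (N₁ + N₂)) S) * (Q : Matrix (Fin (N₁ + N₂)) (Fin (N₁ + N₂)) S) =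
      (Q : Matrix (Fin (N₁ + N₂)) (Fin (N₁ + N₂)) S) * finSum N₁ N₂ B₀ (l • (1 : Matrix (Fin N₂) (Fin N₂) S))) :
    ∃ x : GL (Fin (N₁ + N₂)) S, x ∈ unitaryGroup σ H ∧
      ((x * γ * x⁻¹ : GL (Fin (N₁ + N₂)) S) : Matrix (Fin (N₁ + N₂)) (Fin (N₁ + N₂)) S) * (P : Matrix (Fin (N₁ + N₂)) (Fin (N₁ + N₂)) S) =
        (P : Matrix (Fin (N₁ + N₂)) (Fin (N₁ + N₂)) S) *
          finSum N₁ N₂ ((t₁ : Matrix (Fin N₁) (Fin N₁) S) * B₀ * ((t₁⁻¹ : GL (Fin N₁) S) : Matrix (Fin N₁) (Fin N₁) S)) (l • (1 : Matrix (Fin N₂) (Fin N₂) S)) := by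
  obtain ⟨T, hT, hTi⟩ := exists_units_finSum₃ t₁ t₂
  set Pm : Matrix (Fin (N₁ + N₂)) (Fin (N₁ + N₂)) S := (P : Matrix (Fin (N₁ + N₂)) (Fin (N₁ + N₂)) S) with hPm
  set Pi : Matrix (Fin (N₁ + N₂)) (Fin (N₁ + N₂)) S := ((P⁻¹ : GL (Fin (N₁ + N₂)) S) : Matrix (Fin (N₁ + N₂)) (Fin (N₁ + N₂)) S) with hPi
  set Qm : Matrix (Fin (N₁ + N₂)) (Fin (N₁ + N₂)) S := (Q : Matrix (Fin (N₁ + N₂)) (Fin (N₁ + N₂)) S) with hQm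
  set Qi : Matrix (Fin (N₁ + N₂)) (Fin (N₁ + N₂)) S := ((Q⁻¹ : GL (Fin (N₁ + N₂)) S) : Matrix (Fin (N₁ + N₂)) (Fin (N₁ + N₂)) S) with hQi
  have hQiQm : Qi * Qm = 1 := Units.inv_mul Q
  have hQmQi : Qm * Qi = 1 := Units.mul_inv Q
  have hPiPm : Pi * Pm = 1 := Units.inv_mul P
  set D : Matrix (Fin (N₁ + N₂)) (Fin (N₁ + N₂)) S := finSum N₁ N₂ B₀ (l • (1 : Matrix (Fin N₂) (Fin N₂) S)) with hD
  refine ⟨P * T * Q⁻¹, ?_, ?_⟩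
  · -- unitarity: `ᵗσ(P T Q⁻¹) H (P T Q⁻¹) = ᵗσ(Q⁻¹) [ᵗσT (G₁ ⊕ᶠ G₂) T] Q⁻¹ = ᵗσ(Q⁻¹) (ᵗσQ H Q) Q⁻¹ = H`
    rw [← twistGram_coe_eq_iff_mem_unitaryGroup, Units.val_mul, Units.val_mul, twistGram_mul, twistGram_mul, hP, hT,
      ← twistGram_def σ (finSum N₁ N₂ G₁ G₂), twistGram_finSum_finSum₃, ht₁, ht₂, ← hQ, ← twistGram_mul]
    change twistGram σ H (Qm * Qi) = H
    rw [hQmQi, twistGram_one]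
  · -- conjugation: `P T Q⁻¹ γ Q T⁻¹ P⁻¹ P = P T (Q⁻¹ γ Q) T⁻¹ = P (T D T⁻¹)`
    have hD' : Qi * (γ : Matrix (Fin (N₁ + N₂)) (Fin (N₁ + N₂)) S) * Qm = D := by
      rw [Matrix.mul_assoc, hγQ, ← Matrix.mul_assoc, hQiQm, Matrix.one_mul]
    have hTDT : (T : Matrix (Fin (N₁ + N₂)) (Fin (N₁ + N₂)) S) * D * ((T⁻¹ : GL (Fin (N₁ + N₂)) S) : Matrix (Fin (N₁ + N₂)) (Fin (N₁ + N₂)) S) =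
        finSum N₁ N₂ ((t₁ : Matrix (Fin N₁) (Fin N₁) S) * B₀ * ((t₁⁻¹ : GL (Fin N₁) S) : Matrix (Fin N₁) (Fin N₁) S)) (l • (1 : Matrix (Fin N₂) (Fin N₂) S)) := by
      rw [hT, hTi, hD, finSum_mul_finSum₃, finSum_mul_finSum₃, Matrix.mul_smul, Matrix.mul_one, Matrix.smul_mul, ← Units.val_mul, mul_inv_cancel,
        Units.val_one]
    rw [← hTDT, ← hD']
    have hgrp : P * T * Q⁻¹ * γ * (P * T * Q⁻¹)⁻¹ = P * (T * (Q⁻¹ * γ * Q) * T⁻¹) * P⁻¹ := by group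
    rw [hgrp]
    change Pm * ((T : Matrix (Fin (N₁ + N₂)) (Fin (N₁ + N₂)) S) * (Qi * (γ : Matrix (Fin (N₁ + N₂)) (Fin (N₁ + N₂)) S) * Qm) *
        ((T⁻¹ : GL (Fin (N₁ + N₂)) S) : Matrix (Fin (N₁ + N₂)) (Fin (N₁ + N₂)) S)) * Pi * Pm = _
    rw [Matrix.mul_assoc, hPiPm, Matrix.mul_one]

/-- **TWO FRAME REALISATIONS WITH THE SAME SCALAR BLOCK ⇒ THE RANK-`N₁` GRAM CLASSES AGREE** (NEVER-BOTH, generic form).  If a unitary `y` intertwines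
`P (B ⊕ᶠ l·1) P⁻¹` with `P′ (B′ ⊕ᶠ l·1) P′⁻¹` and `χ_B(l)`, `χ_{B′}(l)` are units, then `s := P′⁻¹ y P` is block diagonal (Sylvester ∕ Cayley–Hamilton), so the Gram
blocks satisfy `G₁ = ᵗ(σs₁) G₁′ s₁` with `s₁` invertible: `det G₁ = σ(det s₁) det s₁ · det G₁′`. [cite: HornJohnson2013, §2.4.4 Cor. 2.4.4.2] [cite: Rogawski1990, §3.8 Prop. 3.8.1 (d) p. 30] -/
theorem exists_det_eq_norm_mul_of_frames (H : Matrix (Fin (N₁ + N₂)) (Fin (N₁ + N₂)) S) {P P' m m' y : GL (Fin (N₁ + N₂)) S}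
    {G₁ G₁' : Matrix (Fin N₁) (Fin N₁) S} {G₂ G₂' : Matrix (Fin N₂) (Fin N₂) S}
    (hP : twistGram σ H (P : Matrix (Fin (N₁ + N₂)) (Fin (N₁ + N₂)) S) = finSum N₁ N₂ G₁ G₂)
    (hP' : twistGram σ H (P' : Matrix (Fin (N₁ + N₂)) (Fin (N₁ + N₂)) S) = finSum N₁ N₂ G₁' G₂')
    {B B' : Matrix (Fin N₁) (Fin N₁) S} {l : S}
    (hm : (m : Matrix (Fin (N₁ + N₂)) (Fin (N₁ + N₂)) S) * (P : Matrix (Fin (N₁ + N₂)) (Fin (N₁ + N₂)) S) =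
      (P : Matrix (Fin (N₁ + N₂)) (Fin (N₁ + N₂)) S) * finSum N₁ N₂ B (l • (1 : Matrix (Fin N₂) (Fin N₂) S)))
    (hm' : (m' : Matrix (Fin (N₁ + N₂)) (Fin (N₁ + N₂)) S) * (P' : Matrix (Fin (N₁ + N₂)) (Fin (N₁ + N₂)) S) =
      (P' : Matrix (Fin (N₁ + N₂)) (Fin (N₁ + N₂)) S) * finSum N₁ N₂ B' (l • (1 : Matrix (Fin N₂) (Fin N₂) S)))
    (hχ : IsUnit (B.charpoly.eval l)) (hχ' : IsUnit (B'.charpoly.eval l))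
    (hy : y ∈ unitaryGroup σ H) (hym : y * m * y⁻¹ = m') :
    ∃ z : S, IsUnit z ∧ G₁.det = σ z * z * G₁'.det := by
  set Pm : Matrix (Fin (N₁ + N₂)) (Fin (N₁ + N₂)) S := (P : Matrix (Fin (N₁ + N₂)) (Fin (N₁ + N₂)) S) with hPm
  set Pi : Matrix (Fin (N₁ + N₂)) (Fin (N₁ + N₂)) S := ((P⁻¹ : GL (Fin (N₁ + N₂)) S) : Matrix (Fin (N₁ + N₂)) (Fin (N₁ + N₂)) S) with hPi
  set P'm : Matrix (Fin (N₁ + N₂)) (Fin (N₁ + N₂)) S := (P' : Matrix (Fin (N₁ + N₂)) (Fin (N₁ + N₂)) S) with hP'm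
  set P'i : Matrix (Fin (N₁ + N₂)) (Fin (N₁ + N₂)) S := ((P'⁻¹ : GL (Fin (N₁ + N₂)) S) : Matrix (Fin (N₁ + N₂)) (Fin (N₁ + N₂)) S) with hP'i
  have hPmPi : Pm * Pi = 1 := Units.mul_inv P
  have hP'iP'm : P'i * P'm = 1 := Units.inv_mul P'
  have hP'mP'i : P'm * P'i = 1 := Units.mul_inv P'
  set D : Matrix (Fin (N₁ + N₂)) (Fin (N₁ + N₂)) S := finSum N₁ N₂ B (l • (1 : Matrix (Fin N₂) (Fin N₂) S)) with hD
  set D' : Matrix (Fin (N₁ + N₂)) (Fin (N₁ + N₂)) S := finSum N₁ N₂ B' (l • (1 : Matrix (Fin N₂) (Fin N₂) S)) with hD'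
  -- `s := P′⁻¹ y P` intertwines `D` and `D′`
  set s : Matrix (Fin (N₁ + N₂)) (Fin (N₁ + N₂)) S := P'i * (y : Matrix (Fin (N₁ + N₂)) (Fin (N₁ + N₂)) S) * Pm with hs
  have hym' : (y : Matrix (Fin (N₁ + N₂)) (Fin (N₁ + N₂)) S) * (m : Matrix (Fin (N₁ + N₂)) (Fin (N₁ + N₂)) S) =
      (m' : Matrix (Fin (N₁ + N₂)) (Fin (N₁ + N₂)) S) * (y : Matrix (Fin (N₁ + N₂)) (Fin (N₁ + N₂)) S) := by
    have h := congrArg (fun u : GL (Fin (N₁ + N₂)) S => ((u * y : GL (Fin (N₁ + N₂)) S) : Matrix (Fin (N₁ + N₂)) (Fin (N₁ + N₂)) S)) hym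
    simpa only [Units.val_mul, inv_mul_cancel_right] using h
  have hm'D : P'i * (m' : Matrix (Fin (N₁ + N₂)) (Fin (N₁ + N₂)) S) = D' * P'i := by
    calc P'i * (m' : Matrix (Fin (N₁ + N₂)) (Fin (N₁ + N₂)) S) = P'i * (m' : Matrix (Fin (N₁ + N₂)) (Fin (N₁ + N₂)) S) * (P'm * P'i) := by
          rw [hP'mP'i, Matrix.mul_one]
      _ = P'i * ((m' : Matrix (Fin (N₁ + N₂)) (Fin (N₁ + N₂)) S) * P'm) * P'i := by simp only [Matrix.mul_assoc]
      _ = D' * P'i := by rw [hm', ← Matrix.mul_assoc, hP'iP'm, Matrix.one_mul]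
  have hsD : s * D = D' * s := by
    calc s * D = P'i * (y : Matrix (Fin (N₁ + N₂)) (Fin (N₁ + N₂)) S) * (Pm * D) := by simp only [hs, Matrix.mul_assoc]
      _ = P'i * ((y : Matrix (Fin (N₁ + N₂)) (Fin (N₁ + N₂)) S) * (m : Matrix (Fin (N₁ + N₂)) (Fin (N₁ + N₂)) S)) * Pm := by
          rw [← hm]; simp only [Matrix.mul_assoc]
      _ = P'i * (m' : Matrix (Fin (N₁ + N₂)) (Fin (N₁ + N₂)) S) * (y : Matrix (Fin (N₁ + N₂)) (Fin (N₁ + N₂)) S) * Pm := by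
          rw [hym']; simp only [Matrix.mul_assoc]
      _ = D' * s := by rw [hm'D]; simp only [hs, Matrix.mul_assoc]
  -- Sylvester: `s` is block diagonal
  set t : Matrix (Fin N₁ ⊕ Fin N₂) (Fin N₁ ⊕ Fin N₂) S := s.submatrix finSumFinEquiv finSumFinEquiv with htdef
  have hst : s = Matrix.reindex finSumFinEquiv finSumFinEquiv t := by
    rw [htdef, Matrix.reindex_apply, Matrix.submatrix_submatrix, Equiv.self_comp_symm, Matrix.submatrix_id_id]
  have ht : t * Matrix.fromBlocks B 0 0 (l • (1 : Matrix (Fin N₂) (Fin N₂) S)) = Matrix.fromBlocks B' 0 0 (l • (1 : Matrix (Fin N₂) (Fin N₂) S)) * t := by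
    have h := congrArg (fun M : Matrix (Fin (N₁ + N₂)) (Fin (N₁ + N₂)) S => M.submatrix ⇑finSumFinEquiv ⇑finSumFinEquiv) hsD
    rw [hD, hD', finSum, finSum, Matrix.reindex_apply, Matrix.reindex_apply,
      ← Matrix.submatrix_mul_equiv s _ ⇑finSumFinEquiv finSumFinEquiv ⇑finSumFinEquiv,
      ← Matrix.submatrix_mul_equiv _ s ⇑finSumFinEquiv finSumFinEquiv ⇑finSumFinEquiv] at h
    simpa only [Matrix.submatrix_submatrix, Equiv.symm_comp_self, Matrix.submatrix_id_id] using h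
  have htb := Matrix.fromBlocks_toBlocks t
  rw [← htb, Matrix.fromBlocks_multiply, Matrix.fromBlocks_multiply] at ht
  simp only [Matrix.mul_zero, Matrix.zero_mul, add_zero, zero_add, Matrix.mul_smul, Matrix.smul_mul, Matrix.mul_one, Matrix.one_mul,
    Matrix.fromBlocks_inj] at ht
  obtain ⟨-, h₁₂, h₂₁, -⟩ := ht
  -- (1,2): `l • t₁₂ = B′ t₁₂` ⇒ `ᵗt₁₂ ᵗB′ = l ᵗt₁₂` ⇒ `t₁₂ = 0`;  (2,1): `t₂₁ B = l t₂₁` ⇒ `t₂₁ = 0`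
  have hC : t.toBlocks₂₁ = 0 := eq_zero_of_mul_eq_smul_of_isUnit_eval_charpoly h₂₁ hχ
  have h12 : (t.toBlocks₁₂)ᵀ * B'ᵀ = l • (t.toBlocks₁₂)ᵀ := by
    rw [← Matrix.transpose_mul, ← h₁₂, Matrix.transpose_smul]
  have hB : t.toBlocks₁₂ = 0 := by
    have h := eq_zero_of_mul_eq_smul_of_isUnit_eval_charpoly h12 (by rw [Matrix.charpoly_transpose]; exact hχ')
    simpa only [Matrix.transpose_eq_zero] using h
  have hsfin : s = finSum N₁ N₂ t.toBlocks₁₁ t.toBlocks₂₂ := by rw [hst, ← htb, hB, hC]; rfl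
  -- Gram transport: `ᵗσ(yP) H (yP) = ᵗσP H P = G₁ ⊕ G₂` and `yP = P′ s`
  have hyP : (y : Matrix (Fin (N₁ + N₂)) (Fin (N₁ + N₂)) S) * Pm = P'm * s := by
    rw [hs, ← Matrix.mul_assoc, ← Matrix.mul_assoc, hP'mP'i, Matrix.one_mul]
  have hG : finSum N₁ N₂ G₁ G₂ = finSum N₁ N₂ (twistGram σ G₁' t.toBlocks₁₁) (twistGram σ G₂' t.toBlocks₂₂) := by
    rw [← hP, ← twistGram_unitary_mul σ H hy Pm, hyP, twistGram_mul, hP', ← twistGram_def, hsfin, twistGram_finSum_finSum₃]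
  obtain ⟨hG₁, -⟩ := finSum_inj₃ hG
  -- `s` is invertible, hence so is its first block
  have hsU : IsUnit s.det := by
    rw [hs, Matrix.det_mul, Matrix.det_mul]
    exact ((Matrix.isUnits_det_units P'⁻¹).mul (Matrix.isUnits_det_units y)).mul (Matrix.isUnits_det_units P)
  rw [hsfin, det_finSum] at hsU
  refine ⟨t.toBlocks₁₁.det, isUnit_of_mul_isUnit_left hsU, ?_⟩
  rw [hG₁, det_twistGram]
  ring

/-- **Rank-1 bookkeeping**: if the Gram blocks of two frames have `det K₁ det K₂ = N(d_R) h`, `det Γ₁ det Γ₂ = N(d_Q) h` with units `d_R`, `d_Q`, `det K₁`, and the rank-`N₁`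
classes agree (`det Γ₁ = det K₁ · N(z)`), then the `1 × 1` blocks agree: `Γ₂ = N(ζ) K₂`. [cite: Rogawski1990, §3.8 Prop. 3.8.1 (d) p. 30] -/
theorem exists_rank_one_eq_norm_smul {K₁ Γ₁ : Matrix (Fin N₁) (Fin N₁) S} {K₂ Γ₂ : Matrix (Fin 1) (Fin 1) S} {h dR dQ : S}
    (hdR : K₁.det * K₂.det = σ dR * h * dR) (hdQ : Γ₁.det * Γ₂.det = σ dQ * h * dQ) (hRu : IsUnit dR) (hQu : IsUnit dQ) (hK₁ : IsUnit K₁.det)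
    (hz : ∃ z : S, IsUnit z ∧ Γ₁.det = K₁.det * (σ z * z)) : ∃ z : S, IsUnit z ∧ Γ₂ = (σ z * z) • K₂ := by
  obtain ⟨z, ⟨zu, rfl⟩, hz⟩ := hz
  obtain ⟨ρ, rfl⟩ := hRu
  -- `ζ := d_Q · ρ⁻¹ · z⁻¹`
  refine ⟨dQ * ((ρ⁻¹ : Sˣ) : S) * ((zu⁻¹ : Sˣ) : S), (hQu.mul (ρ⁻¹).isUnit).mul (zu⁻¹).isUnit, Matrix.ext fun i j => ?_⟩
  · obtain rfl : i = 0 := Subsingleton.elim _ _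
    obtain rfl : j = 0 := Subsingleton.elim _ _
    have hρi : (ρ : S) * ((ρ⁻¹ : Sˣ) : S) = 1 := ρ.mul_inv
    have hzi : (zu : S) * ((zu⁻¹ : Sˣ) : S) = 1 := zu.mul_inv
    have hσρi : σ (ρ : S) * σ ((ρ⁻¹ : Sˣ) : S) = 1 := by rw [← map_mul, hρi, map_one]
    have hσzi : σ (zu : S) * σ ((zu⁻¹ : Sˣ) : S) = 1 := by rw [← map_mul, hzi, map_one]
    have e1 : K₁.det * (σ (zu : S) * (zu : S)) * Γ₂.det = σ dQ * h * dQ := by rw [← hz]; exact hdQ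
    have key : K₁.det * Γ₂.det = K₁.det * (σ (dQ * ((ρ⁻¹ : Sˣ) : S) * ((zu⁻¹ : Sˣ) : S)) * (dQ * ((ρ⁻¹ : Sˣ) : S) * ((zu⁻¹ : Sˣ) : S)) * K₂.det) := by
      rw [map_mul, map_mul]
      linear_combination (σ ((zu⁻¹ : Sˣ) : S) * ((zu⁻¹ : Sˣ) : S)) * e1
        - (σ dQ * dQ * σ ((ρ⁻¹ : Sˣ) : S) * ((ρ⁻¹ : Sˣ) : S) * σ ((zu⁻¹ : Sˣ) : S) * ((zu⁻¹ : Sˣ) : S)) * hdR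
        - (K₁.det * Γ₂.det * (zu : S) * ((zu⁻¹ : Sˣ) : S)) * hσzi - (K₁.det * Γ₂.det) * hzi
        - (σ ((zu⁻¹ : Sˣ) : S) * ((zu⁻¹ : Sˣ) : S) * (σ dQ * h * dQ) * (ρ : S) * ((ρ⁻¹ : Sˣ) : S)) * hσρi
        - (σ ((zu⁻¹ : Sˣ) : S) * ((zu⁻¹ : Sˣ) : S) * (σ dQ * h * dQ)) * hρi
    have hΓ₂ : Γ₂.det = σ (dQ * ((ρ⁻¹ : Sˣ) : S) * ((zu⁻¹ : Sˣ) : S)) * (dQ * ((ρ⁻¹ : Sˣ) : S) * ((zu⁻¹ : Sˣ) : S)) * K₂.det :=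
      (IsUnit.mul_right_inj hK₁).mp key
    rw [Matrix.smul_apply, smul_eq_mul, ← Matrix.det_fin_one Γ₂, ← Matrix.det_fin_one K₂]
    exact hΓ₂

end Generic

end Literature.NumberTheory.Rogawski1990

end
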